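import Literature.NumberTheory.DiophantineGeometry.FaltingsHeight
import Literature.NumberTheory.EllipticCurves.IsogenyDualProofs
import Literature.NumberTheory.EllipticCurves.IsogenyCanonicalHeightProofs
import HarnessLib

/-!
# Faltings' isogeny inequality, two-sided form: `|h_F(E) − h_F(E')| ≤ ½ log deg φ`

Topic `NumberTheory/DiophantineGeometry`; a proofs-only sibling of `FaltingsHeight.lean` (one
theorem: no definitions, no named facts). The named fact
`WeierstrassCurve.stableFaltingsHeight_le_of_isogeny` (Faltings 1983, §3, Lemma 5:
`h_F(E') ≤ h_F(E) + ½ log deg φ` for an isogeny `φ : E → E'` over a number field) applied to `φ`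
and to its dual `φ̂ : E' → E` (Silverman, *AEC*, Thm. III.6.1(a): `φ̂ ∘ φ = [deg φ]`, the tree's
`Isogeny.exists_dual_of_isElliptic`; Thm. III.6.2(e): `deg φ̂ = deg φ`, the tree's
`Isogeny.degree_eq_of_comp_eq_degree_smul`) gives the two-sided inequality
`|h_F(E) − h_F(E')| ≤ ½ log deg φ` — the form used by Pasten 2024, §3
(`|h(A_{1,N}) − h(E)| ≤ ½ log 163`), and the elliptic-curve case of the interface lemma
`FaltingsHeightTheory.abs_hF_sub_hF_le` of `FaltingsHeight.lean`. As every consumer of a named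
fact, the theorem takes the fact as its hypothesis `(h : stableFaltingsHeight_le_of_isogeny)`.

## References

* [Faltings1986FinitenessTranslation] G. Faltings, *Finiteness theorems for abelian varieties
  over number fields*, in Cornell–Silverman, *Arithmetic Geometry*, Ch. II, §3, Lemma 5 and the
  Remark following it.
* [SilvermanAEC2009] J. H. Silverman, *The Arithmetic of Elliptic Curves*, 2nd ed., Thm. III.6.1(a),
  Thm. III.6.2(e).
* [PastenShimura2024] H. Pasten, *Shimura curves and the abc conjecture*, §3.
-/

noncomputable section

namespace WeierstrassCurve

/-- **`|h_F(E) − h_F(E')| ≤ ½ log deg φ`** for an isogeny `φ : E → E'` of elliptic curves over a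
number field, from Faltings' inequality `h_F(E') ≤ h_F(E) + ½ log deg φ` (the named fact
`stableFaltingsHeight_le_of_isogeny`, hypothesis `h`) applied to `φ` and to the dual isogeny
`φ̂ : E' → E`, which is again defined over `K` with `φ̂ ∘ φ = [deg φ]`
(`Isogeny.exists_dual_of_isElliptic`, Silverman *AEC* III.6.1(a)) and has `deg φ̂ = deg φ`
(`Isogeny.degree_eq_of_comp_eq_degree_smul`, *AEC* III.6.2(e)). Faltings 1983, §3, Remark after
Lemma 5 (the height difference along an isogeny is controlled by `deg φ` in both directions).
(Dot-notation extension of Mathlib's `WeierstrassCurve`.)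
[cite: Faltings1986FinitenessTranslation, §3 Lemma 5 and Remark] -/
theorem abs_stableFaltingsHeight_sub_le (h : stableFaltingsHeight_le_of_isogeny) {K : Type}
    [Field K] [NumberField K] (W W' : WeierstrassCurve K) [W.IsElliptic] [W'.IsElliptic]
    (φ : Isogeny W W') :
    |W.stableFaltingsHeight - W'.stableFaltingsHeight| ≤ 1 / 2 * Real.log φ.degree := by
  obtain ⟨ψ, hψ⟩ := Isogeny.exists_dual_of_isElliptic φ
  have hdeg : ψ.degree = φ.degree := Isogeny.degree_eq_of_comp_eq_degree_smul φ ψ hψ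
  have h₁ := h W W' φ
  have h₂ := h W' W ψ
  rw [hdeg] at h₂
  rw [abs_sub_le_iff]
  constructor <;> linarith

end WeierstrassCurve

end
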